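import Summits.BirchSwinnertonDyer.BirchSwinnertonDyer.Theorems.ResidualThetaTransportAtTwoSignedMuSeedAtTwoPlusJetRobertLevelOne
import Summits.BirchSwinnertonDyer.BirchSwinnertonDyer.Theorems.ResidualThetaTransportAtTwoSignedMuSeedAtTwoPlusTiltRotation
import Summits.BirchSwinnertonDyer.BirchSwinnertonDyer.Theorems.ResidualThetaTransportAtTwoSignedMuSeedAtTwoPlusJetLaurentPoint
import HarnessLib

/-!
# The single Robert factor `1/(x + c)` (calibration class, `N𝔩 = 3`, `𝔣₀ = 1`): `θ_c = (x(t) + c)⁻¹` in `k⸨t⸩`, `NonDeg(1)` for `c ≠ 0`,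
# and the NEGATIVE CONTROLS `c = 0 ⟹ S₀ = 0`, `ρ`-stable pole sets `⟹ p₁ = 0`
# (seed lines `norm-field-tilt` / `jet-character-sums`; crux `SignedMuSeedAtTwoPlus` stmt-BirchSwinnertonDyer-21438; Kμ⁺ stmt-BirchSwinnertonDyer-20689)

Cell `bsd-wall`, width seat `bsd-wall-rtt-p4-w2` g14 (`--supports`, closes nothing).  THEOREMS ONLY; the lines are NOT registered (W-79);
BSD is not proved by this.

* §1 **`coe_robertFactor_mul_laurentX_add`** (field `k`): the power series `θ_c` with `θ_c·(t + c·w) = w` IS `1/(x(t) + c)` for the tree's Laurent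
  `x`-coordinate `WeierstrassCurve.laurentX` of the formal point (`x(t) = t/w(t)`, `…JetLaurentPoint.laurentX_eq_div`) — the name is honest.
* §2 `ρ`-weights of `w`: **`coeff_formalW_eq_zero_of_mod_three_ne_zero`** (`λ² + λ + 1 = 0` in `k`, char `2`: `[tⁿ]w = 0` unless `3 ∣ n`, from
  `Tilt.rescale_formalW`); hence for the `ρ`-FIXED pole `c = 0` (`θ₀ = w/t = 1/x`): `[tⁿ]θ₀ = 0` unless `n ≡ 2 (mod 3)` and
  **`rhoSymm_robertFactor_zero`: `S₀ = λθ₀(λt) + λ²θ₀(λ²t) = 0`** — total degeneracy (the divisor of `1/x` is `ρ`-invariant; cf. `Tilt.coboundary_not_nonDeg`).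
* §3 **`sum_eq_zero_of_rho_stable`**: a pole set stable under `c ↦ λc` has `p₁ = Σ cᵢ = 0` (`(1 + λ)p₁ = 0`, `1 + λ = λ²` a unit), hence
  `t¹² ∣ S₀ ∧ t¹⁴ ∣ S₁` (`slow_of_rho_stable`, via `levelOne_robertSum_dichotomy`): `ρ`-stable `𝔩`-subgroups are slow at levels `0, 1`.
* §4 the single factor, `c ≠ 0`: `coeff_twelve_levelOne_robertFactor` (`[t¹²]S₁ = c²(ū + ū²)`), **`nonDeg_one_robertFactor`** (reduced ring,
  `ū² + ū + 1 = 0`: `ord S₀ = 4`, `ord S₁ = 12`, `12 + 2 < 4²`) — the calibration row `(4, 12)` of `Lines/norm-field-tilt.md` for `θ̄ = 1/(x + x_P)`,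
  `x_P ≠ 0`, as a theorem.

References: the cards; [SilvermanAEC2009] IV.1. [folklore]
-/

set_option autoImplicit false
-- the Theorems namespace of this sub repeats the summit name by design (D-0017 nested layout)
set_option linter.dupNamespace false

noncomputable section

open scoped Classical LaurentSeries
open PowerSeries Finset

namespace Summit.BirchSwinnertonDyer.BirchSwinnertonDyer.Theorems.SignedMuAtTwo.JetCharacterSums

/-! ## §1 `θ_c = 1/(x(t) + c)` in `k⸨t⸩` -/

section Laurent

variable {k : Type*} [Field k]

/-- **The Robert factor is `1/(x + c)`**: for the tree's Laurent `x`-coordinate `x(t) = laurentX t` of the formal point of `Ẽ = y² + y = x³`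
(`x(t) = t/w(t)`), the power series `θ_c` with `θ_c·(t + c·w) = w` satisfies `θ_c · (x(t) + c) = 1` in `k⸨t⸩`. [cite: SilvermanAEC2009, IV.1.1] -/
theorem coe_robertFactor_mul_laurentX_add (c : k) {θ : k⟦X⟧}
    (hθ : θ * (X + C c * (⟨0, 0, 1, 0, 0⟩ : WeierstrassCurve k).formalW) = (⟨0, 0, 1, 0, 0⟩ : WeierstrassCurve k).formalW) :
    ((θ : k⟦X⟧) : k⸨X⸩) * ((⟨0, 0, 1, 0, 0⟩ : WeierstrassCurve k).laurentX X + algebraMap k k⸨X⸩ c) = 1 := by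
  have hX : ∀ f : k⟦X⟧, f.subst (X : k⟦X⟧) = f := fun f => by
    rw [← map_algebraMap_eq_subst_X f, Algebra.algebraMap_self, map_id]; rfl
  have hθ' : θ * (X + C c * (⟨0, 0, 1, 0, 0⟩ : WeierstrassCurve k).formalW.subst (X : k⟦X⟧)) =
      (⟨0, 0, 1, 0, 0⟩ : WeierstrassCurve k).formalW.subst (X : k⟦X⟧) := by rw [hX]; exact hθ
  have hw : (((⟨0, 0, 1, 0, 0⟩ : WeierstrassCurve k).formalW.subst (X : k⟦X⟧) : k⟦X⟧) : k⸨X⸩) ≠ 0 :=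
    WeierstrassCurve.coe_laurent_ne_zero (formalW_subst_ne_zero constantCoeff_X X_ne_zero)
  have hco := congrArg (fun f : k⟦X⟧ => (f : k⸨X⸩)) hθ'
  simp only [PowerSeries.coe_mul, PowerSeries.coe_add] at hco
  rw [laurentX_eq_div constantCoeff_X X_ne_zero, WeierstrassCurve.algebraMap_laurentSeries_eq_coe_C, div_add' _ _ _ hw,
    ← mul_div_assoc, hco, div_self hw]

end Laurent

variable {R : Type*} [CommRing R] [CharP R 2]

/-! ## §2 `ρ`-weights: `[tⁿ]w = 0` unless `3 ∣ n`; the `ρ`-fixed pole `c = 0` is invisible -/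

section RhoWeights

variable {l : R} (hl : l ^ 2 + l + 1 = 0)

include hl

/-- **`[tⁿ]w = 0` unless `3 ∣ n`** (`w(λt) = w(t)` for `λ³ = 1`, `Tilt.rescale_formalW`; in characteristic `2` with `λ² + λ + 1 = 0` the factors
`λ + 1 = λ²`, `λ² + 1 = λ` are units). [cite: SilvermanAEC2009, IV.1.1] -/
theorem coeff_formalW_eq_zero_of_mod_three_ne_zero {n : ℕ} (hn : n % 3 ≠ 0) :
    coeff n (⟨0, 0, 1, 0, 0⟩ : WeierstrassCurve R).formalW = 0 := by
  have h3 : l ^ 3 = 1 := pow_three_eq_one_of_rho hl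
  have h2 : (2 : R) = 0 := CharTwo.two_eq_zero
  have h := congrArg (coeff n) (Tilt.rescale_formalW (⟨0, 0, 1, 0, 0⟩ : WeierstrassCurve R) rfl rfl rfl h3)
  rw [coeff_rescale] at h
  set a := coeff n (⟨0, 0, 1, 0, 0⟩ : WeierstrassCurve R).formalW with ha
  have hln : l ^ n = l ^ (n % 3) := by
    conv_lhs => rw [← Nat.div_add_mod n 3, pow_add, pow_mul, h3, one_pow, one_mul]
  rw [hln] at h
  have hcases : n % 3 = 1 ∨ n % 3 = 2 := by omega
  rcases hcases with h1 | h1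
  · rw [h1, pow_one] at h
    -- `l a = a` ⟹ `a = l(l + 1) a = … = 0`
    linear_combination (-(l + 2)) * h + a * hl - a * h2
  · rw [h1] at h
    -- `l² a = a`
    linear_combination (l - 1) * h + a * hl - a * h3 - a * h2

/-- For the `ρ`-fixed pole `c = 0` (`θ₀ = w/t = 1/x`): **`[tⁿ]θ₀ = 0` unless `n ≡ 2 (mod 3)`**. [folklore] -/
theorem coeff_robertFactor_zero_eq_zero {θ : R⟦X⟧}
    (hθ : θ * (X + C 0 * (⟨0, 0, 1, 0, 0⟩ : WeierstrassCurve R).formalW) = (⟨0, 0, 1, 0, 0⟩ : WeierstrassCurve R).formalW)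
    {n : ℕ} (hn : n % 3 ≠ 2) : coeff n θ = 0 := by
  rw [map_zero, zero_mul, add_zero] at hθ
  have h := congrArg (coeff (n + 1)) hθ
  rw [coeff_succ_mul_X] at h
  rw [h]
  exact coeff_formalW_eq_zero_of_mod_three_ne_zero hl (by omega)

/-- **The `ρ`-fixed pole is invisible: `S₀ = λθ₀(λt) + λ²θ₀(λ²t) = 0`** for `θ₀ = 1/x` — total degeneracy at every level (the negative control:
a Robert function whose divisor is `ρ`-invariant tilts to a `ρ`-product with vanishing `D log`). [folklore] -/
theorem rhoSymm_robertFactor_zero {θ : R⟦X⟧}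
    (hθ : θ * (X + C 0 * (⟨0, 0, 1, 0, 0⟩ : WeierstrassCurve R).formalW) = (⟨0, 0, 1, 0, 0⟩ : WeierstrassCurve R).formalW) :
    C l * rescale l θ + C (l ^ 2) * rescale (l ^ 2) θ = 0 := by
  ext n
  rw [coeff_rhoSymm_eq hl, map_zero]
  split_ifs with h
  · rfl
  · exact coeff_robertFactor_zero_eq_zero hl hθ h

end RhoWeights

/-! ## §3 `ρ`-stable pole sets are slow: `p₁ = 0` -/

section RhoStable

variable {ι : Type*} {s : Finset ι} {c : ι → R} {l : R} (hl : l ^ 2 + l + 1 = 0)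

include hl

/-- **A `ρ`-stable pole set has `p₁ = 0`**: if a permutation `σ` of the index set preserves `s` and rotates the poles, `c(σ i) = λ·c(i)`, then
`Σᵢ cᵢ = λ·Σᵢ cᵢ`, so `(1 + λ)·p₁ = 0` with `1 + λ = λ²` a unit: `p₁ = 0`. [folklore] -/
theorem sum_eq_zero_of_rho_stable (σ : Equiv.Perm ι) (hs : s.map σ.toEmbedding = s) (hc : ∀ i ∈ s, c (σ i) = l * c i) :
    ∑ i ∈ s, c i = 0 := by
  have h2 : (2 : R) = 0 := CharTwo.two_eq_zero
  have hsum : ∑ i ∈ s, c i = l * ∑ i ∈ s, c i := by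
    conv_lhs => rw [← hs, Finset.sum_map]
    rw [Finset.mul_sum]
    exact Finset.sum_congr rfl fun i hi => hc i hi
  set p := ∑ i ∈ s, c i with hp
  linear_combination (l + 2) * hsum + p * hl - p * h2

variable {θ : ι → R⟦X⟧}
  (hθ : ∀ i ∈ s, θ i * (X + C (c i) * (⟨0, 0, 1, 0, 0⟩ : WeierstrassCurve R).formalW) = (⟨0, 0, 1, 0, 0⟩ : WeierstrassCurve R).formalW)
  {δ : R⟦X⟧} {u : R} (hδ : (X : R⟦X⟧) ^ 8 ∣ δ - C u * X ^ 4)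

include hθ hδ

/-- **`ρ`-stable pole sets are slow at levels `0` and `1`**: `t¹² ∣ S₀` and `t¹⁴ ∣ S₁` (`ū² + ū + 1 = 0`). [folklore] -/
theorem slow_of_rho_stable (hu : u ^ 2 + u + 1 = 0) (σ : Equiv.Perm ι) (hs : s.map σ.toEmbedding = s)
    (hc : ∀ i ∈ s, c (σ i) = l * c i) :
    (X : R⟦X⟧) ^ 12 ∣ C l * rescale l (∑ i ∈ s, θ i) + C (l ^ 2) * rescale (l ^ 2) (∑ i ∈ s, θ i) ∧
      (X : R⟦X⟧) ^ 14 ∣ (C l * rescale l (∑ i ∈ s, θ i) + C (l ^ 2) * rescale (l ^ 2) (∑ i ∈ s, θ i)) +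
        (C l * rescale l (∑ i ∈ s, θ i) + C (l ^ 2) * rescale (l ^ 2) (∑ i ∈ s, θ i)).subst (X + δ) :=
  (levelOne_robertSum_dichotomy hθ hl hδ hu).2.2.2.2 (sum_eq_zero_of_rho_stable hl σ hs hc)

end RhoStable

/-! ## §4 The single factor `1/(x + c)`, `c ≠ 0`: the calibration row `(4, 12)` -/

section Single

variable {c : R} {θ : R⟦X⟧}
  (hθ : θ * (X + C c * (⟨0, 0, 1, 0, 0⟩ : WeierstrassCurve R).formalW) = (⟨0, 0, 1, 0, 0⟩ : WeierstrassCurve R).formalW)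
  {l : R} (hl : l ^ 2 + l + 1 = 0) {δ : R⟦X⟧} {u : R} (hδ : (X : R⟦X⟧) ^ 8 ∣ δ - C u * X ^ 4)

include hθ hl

/-- `[t⁴]S₀ = c` and `t⁴ ∣ S₀` for the single factor (level `0` degenerate). [folklore] -/
theorem coeff_four_rhoRobertFactor :
    coeff 4 (C l * rescale l θ + C (l ^ 2) * rescale (l ^ 2) θ) = c ∧ (X : R⟦X⟧) ^ 4 ∣ C l * rescale l θ + C (l ^ 2) * rescale (l ^ 2) θ := by
  have hθ' : ∀ i ∈ ({0} : Finset (Fin 1)), (fun _ => θ) i * (X + C ((fun _ => c) i) * (⟨0, 0, 1, 0, 0⟩ : WeierstrassCurve R).formalW) =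
      (⟨0, 0, 1, 0, 0⟩ : WeierstrassCurve R).formalW := fun _ _ => hθ
  have h4 := coeff_four_rhoRobertSum hθ' hl
  have hd := X_pow_four_dvd_rhoRobertSum hθ' hl
  simp only [Finset.sum_singleton] at h4 hd
  exact ⟨h4, hd⟩

include hδ

/-- **`[t¹²]S₁ = c²·(ū + ū²)`** for the single factor `1/(x + c)`. [folklore] -/
theorem coeff_twelve_levelOne_robertFactor :
    coeff 12 ((C l * rescale l θ + C (l ^ 2) * rescale (l ^ 2) θ) + (C l * rescale l θ + C (l ^ 2) * rescale (l ^ 2) θ).subst (X + δ)) =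
      c ^ 2 * (u + u ^ 2) := by
  have hθ' : ∀ i ∈ ({0} : Finset (Fin 1)), (fun _ => θ) i * (X + C ((fun _ => c) i) * (⟨0, 0, 1, 0, 0⟩ : WeierstrassCurve R).formalW) =
      (⟨0, 0, 1, 0, 0⟩ : WeierstrassCurve R).formalW := fun _ _ => hθ
  have h := coeff_twelve_levelOne_robertSum hθ' hl hδ
  simp only [Finset.sum_singleton] at h
  exact h

/-- **`NonDeg(1)` for the calibration Robert function `1/(x + c)`, `c ≠ 0`** (reduced ring, `λ² + λ + 1 = 0`, `ū² + ū + 1 = 0`, `δ ≡ ūt⁴ (mod t⁸)`):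
`ord S₀ = 4` and `ord S₁ = 12` (`12 + 2 < 4²`) — the row `(v(S₀), v(S₁)) = (4, 12)` of the engine table for `K = ℚ(√−11)`, `𝔣 = (2)`,
`θ̄ = 1/(x + x_P)`, now for every `x_P ≠ 0`. [folklore] -/
theorem nonDeg_one_robertFactor [IsReduced R] (hu : u ^ 2 + u + 1 = 0) (hc : c ≠ 0) :
    PowerSeries.order (C l * rescale l θ + C (l ^ 2) * rescale (l ^ 2) θ) = ((4 : ℕ) : ℕ∞) ∧
      PowerSeries.order ((C l * rescale l θ + C (l ^ 2) * rescale (l ^ 2) θ) +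
        (C l * rescale l θ + C (l ^ 2) * rescale (l ^ 2) θ).subst (X + δ) : R⟦X⟧) = ((12 : ℕ) : ℕ∞) ∧
      (12 + 2 < 4 ^ (1 + 1)) := by
  have hθ' : ∀ i ∈ ({0} : Finset (Fin 1)), (fun _ => θ) i * (X + C ((fun _ => c) i) * (⟨0, 0, 1, 0, 0⟩ : WeierstrassCurve R).formalW) =
      (⟨0, 0, 1, 0, 0⟩ : WeierstrassCurve R).formalW := fun _ _ => hθ
  have hp : ∑ i ∈ ({0} : Finset (Fin 1)), (fun _ => c) i ≠ 0 := by simpa using hc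
  have h := nonDeg_one_robertSum hθ' hl hδ hu hp
  simp only [Finset.sum_singleton] at h
  exact ⟨h.1, h.2.1, h.2.2.2⟩

end Single

end Summit.BirchSwinnertonDyer.BirchSwinnertonDyer.Theorems.SignedMuAtTwo.JetCharacterSums

end
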